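import Literature.MathematicalPhysics.QuantumFieldTheory.Balaban1983to89.B14Eq344PolymerRatio

/-!
# `Balaban1983to89.B14.Eq347Letters` — [Balaban1988Convergent] (3.47) p. 278: «The terms of the sum above satisfy the
# bounds (2.42), with the constant B₀ replaced by O(p₀³(g_k))» — the (3.47) term bound FROM THE ACTIVITY LETTERS ALONE
# (the Kotecký–Preiss hypothesis of `…B14Eq344PolymerRatio.norm_E0_window_le_of_decay` DISCHARGED), with explicit rate and
# smallness thresholds for a prescribed target decay rate — the `Step.LFHypImproved` SHAPE of the pre-𝐑 new terms of p. 279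

HONEST FRAMING (cell `pub-ymgap`, Track A DAG node N11 = [B14]; count-neutral SLOT input).  A located hypothesis
discharge and a re-packaging of a landed kernel theorem; no new estimate of Bałaban's is claimed.  The window ∕
`ℤ^d`-box currency of the tree's (3.44)–(3.47) file (`TreeLengthCubeSystem`: localization domains `Dom B` of a finite
window `B`, incompatibility `Touch B`, size = tree length) is inherited as is; the ACTIVITY LETTERS (decay of the
polymer activities `H`, `H′` of (3.44)) are hypotheses — in print they are the output of «Lemmas 5, 6 [I] with the
corresponding changes» (p. 276), i.e. of [Balaban1988RG2Cluster] applied with the multi-scale covers of p. 275, which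
this file does not touch; nothing of Bałaban's minimizers `U_k` is instantiated; one finite T⁴ programme at fixed ε;
nothing here is a claim about the continuum, ℝ⁴, OS axioms, a mass gap or the Clay problem.

CITATION HEADER (lean-in-tree rule).  T. Bałaban, *Convergent renormalization expansions for lattice gauge theories*,
Commun. Math. Phys. **119** (1988) 243–285, doi:10.1007/bf01217741 [Balaban1988Convergent] (cell paper B14 = «[III]»;
held text `paper:balaban1988-cmp119-convergent-renormalization`, journal page = PDF page + 242; pp. 276–279 [PDF 34–37]
and p. 262 [PDF 20] read from the text layer by the author of this file, 2026-08-26).  THE PRINT, verbatim.  p. 278: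
*«Finally, the exponential on the right-hand side of (3.46) is expanded into the Mayer expansion, as the action density
(I.7.1). This, after the proper resummation, yields the representation  [the expectation value in (3.37)] = Σ_{X∈𝐃_{k+1},
X⊃b} 𝐄₀^{(k+1)}(Λ_{k+1}, X, b). (3.47)  There is also the dependence on the variable t, suppressed in the above formula.
The terms of the sum above satisfy the bounds (2.42), with the constant B₀ replaced by O(p₀³(g_k)). … We obtain an
expansion of the form (3.47), with terms satisfying the bounds (I.1.18). … After the integration we get a representation
of the form (3.47), with terms satisfying (2.42).»*; p. 279: *«Thus we have finished the decomposition of the logarithm of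
the fluctuation field integral in (3.25) into the sum of the three terms: 𝐄^{(k+1)}, 𝐑″^{(k+1)}, and 𝐁^{(k+1)}. These
terms satisfy all the conditions of the inductive assumption.»*; p. 262: *«the newly created terms … satisfy better
bounds. … they have better decay properties, with the number κ replaced, for example, by (1+4β)κ.»*; (2.42) p. 261:
*«|𝐁^{(j)}(X, (𝐔,𝐉), A, {S_i∩X})| < B₀ exp(−κ d_j(X))»*.  [Balaban1988RG2Cluster] p. 20 (after (2.38)): *«The above
lemma implies that sufficient conditions for convergence of the series (2.12), (2.13) are satisfied, see [26, 67, 25,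
50]»* (= the Kotecký–Preiss condition, tree `Literature.Probability.LatticeModels.IsKPVolume`, [KoteckyPreiss1986] (1)).

BY NAME AND UNCHANGED.  `…B14Eq344PolymerRatio` (unit lit-balaban-p25): `E0` (the (3.47) terms), `domsWith`,
`TouchesCells`, `dW` (tree length of a cube family), `Good`, **`norm_E0_window_le_of_decay`** (the (2.42)-type bound on
the (3.47) terms in the window model from: the Kotecký–Preiss hypothesis `hKP : IsKPVolume (Touch B) H a univ`, the
activity letters `‖H Z‖ ≤ A e^{−R d(Z)}`, `‖H′ Z₀‖ ≤ A′ e^{−R′ d(Z₀)}`, and explicit rate ∕ smallness conditions);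
`…B13Resummation.kp_condition` ([Balaban1988RG2Cluster] p. 20: the KP inequality from activity decay, (1.26) and the
volume bound); `…TreeLengthCubeSystem` (`Dom`, `Cell`, `cellsOf`, `Touch`, `reach`, `loc_of_touch`, `card_reach_le`,
`geometry` — the window's polymer geometry with (1.26) and the volume bound PROVED); `…B12TreeDecay` (`kappa₀`, `K₀`);
`Literature.Probability.LatticeModels.ClusterExpansion` (`IsKPVolume`, `kp_hypothesis_of_fintype`, `isKPVolume_of_tsum_le`).

WHAT THIS FILE PROVES (0 `sorry`, 0 `def`, standard axioms).
* §1 `isKPVolume_window_of_decay` — **the Kotecký–Preiss condition for the window's polymer gas from the activity letters**: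
  `‖H Z‖ ≤ A e^{−R d(Z)}`, `R ≥ κ₀ + 4·2^d τ`, `A e^{4·2^d τ} K₀ (2d+1) ≤ τ` ⟹ `IsKPVolume (Touch B) H (Z ↦ τ·#cells Z) univ`
  (κ₀ = κ₀(4·2^d, 2d), K₀ = K₀(4·2^d, 2d) of (1.26) [II]) — `B13Resummation.kp_condition` on `TreeLengthCubeSystem.geometry`,
  the pattern of `B13Resummation.exp_sum_locE_eq_Z` ∕ `B16CurlyBracketVolume.isKPVolume_rel`, exported for this gas;
  `isKPVolume_window_of_decayLetters` — the same from the (stronger) rate ∕ smallness letters of `norm_E0_window_le_of_decay`.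
* §2 **`norm_E0_window_le_of_letters`** — p. 278's sentence as a kernel theorem WITH ONLY THE ACTIVITY LETTERS AND
  ARITHMETIC AS HYPOTHESES: `norm_E0_window_le_of_decay` with `hKP` discharged by §1.
* §3 (private `one_le_K₀_window`: `1 ≤ K₀(4·2^d, 2d)`), **`norm_E0_window_le_rate`** — the free parameters of §2 (τ, b, r₁, κ₂) FIXED for a prescribed target
  rate `κ ≥ 0`: if `R ≥ κ + 3κ₀ + 2`, `R′ ≥ κ + κ₀ + 1` and `A · 2(4·2^d)²K₀³(2d+1)² e^{7κ+5κ₀+1} ≤ 1`, then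
  `‖𝐄₀(X, c)‖ ≤ (e·K₀)·A′·e^{−κ·d(X)}` — «O(1)·A′», O(1) = e·K₀(4·2^d, 2d) depending on `d` only.
* §4 **`norm_E0_window_le_target`** — the `Step.LFHypImproved.boundE ∕ boundR ∕ boundB` SHAPE for the pre-𝐑 families of
  p. 279 at window level: for a target constant `M` and target rate `κ⋆` (read `κ⋆ := (1+4β)κ`, p. 262; `M := E₀` for
  𝐄^{(k+1)}, `g_{k+1}^{κ₀}` for 𝐑″^{(k+1)}, `B₀` for 𝐁^{(k+1)}; the marked letter `A′` = «O(p₀³(g_k))» resp. the (I.1.18) ∕ (2.42)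
  amplitudes), letters at rates ≥ the §3 thresholds with `e·K₀·A′ ≤ M` give `‖𝐄₀(X, c)‖ ≤ M·e^{−κ⋆·d(X)}`; and
  `norm_E0_window_le_improved` — the literal `(1+4β)κ` instance.

HONEST SCOPE.  (1) The one mathematical step here is [KoteckyPreiss1986]'s hypothesis (1) verified from activity decay +
(1.26) + the volume bound — in print a sentence of [II] p. 20; everything else is `norm_E0_window_le_of_decay` by name and
real arithmetic.  (2) The thresholds of §3 are ONE admissible choice of the free parameters (τ = (4·2^d)⁻¹, r₁ = κ + κ₀,
b = 5r₁ + 2κ + log(2(4·2^d)K₀²(2d+1)), κ₂ = κ₀), not optimal.  (3) Window ∕ `ℤ^d`-box currency; the identification of the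
window's localization domains with Bałaban's 𝐃_{k+1} on the torus and of `dW` with `d_{k+1}` is the one-carrier task of
NODE 00 (not made here); the `t`-dependence of p. 278 («the integration with respect to t preserves the form») is not typed.

## References
* [Balaban1988Convergent] T. Bałaban, Commun. Math. Phys. **119** (1988) 243–285: (3.44)–(3.47) pp. 277–278, p. 279, (2.42) p. 261, p. 262.
* [Balaban1988RG2Cluster] T. Bałaban, Commun. Math. Phys. **116** (1988) 1–22: (2.11)–(2.13) p. 14, (2.38) and the sentence after it p. 20.
* [KoteckyPreiss1986] R. Kotecký, D. Preiss, Commun. Math. Phys. **103** (1986) 491–498: condition (1), Theorem p. 492.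
-/

open scoped BigOperators

namespace Literature.MathematicalPhysics.QuantumFieldTheory.Balaban1983to89.B14.Eq347Letters

open Literature.Probability.LatticeModels
open Literature.MathematicalPhysics.QuantumFieldTheory.Balaban1983to89
open Literature.MathematicalPhysics.QuantumFieldTheory.Balaban1983to89.B13ScaleTransfer (Pt)
open Literature.MathematicalPhysics.QuantumFieldTheory.Balaban1983to89.TreeLength (treeLen treeLen_nonneg)
open Literature.MathematicalPhysics.QuantumFieldTheory.Balaban1983to89.TreeLengthCubeSystem
  (Dom Cell cellsOf Touch reach card_reach_le loc_of_touch geometry)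
open Literature.MathematicalPhysics.QuantumFieldTheory.Balaban1983to89.B12TreeDecay (kappa₀ K₀ K₀_pos kappa₀_nonneg)
open Literature.MathematicalPhysics.QuantumFieldTheory.Balaban1983to89.B13Resummation (locE)
open Literature.MathematicalPhysics.QuantumFieldTheory.Balaban1983to89.B14Eq344PolymerRatio
  (E0 domsWith TouchesCells dW norm_E0_window_le_of_decay)

variable {d : ℕ} (B : Finset (Pt d))

/-! ## §1  The Kotecký–Preiss condition of the window gas from the activity letters -/

/-- **The Kotecký–Preiss condition for the window's polymer gas from activity decay** ([Balaban1988RG2Cluster] p. 20: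
*«The above lemma implies that sufficient conditions for convergence of the series (2.12), (2.13) are satisfied»*; used on
p. 278 of [Balaban1988Convergent]: *«The sum is exponentiated»*): if `‖H Z‖ ≤ A e^{−R d(Z)}` on the localization domains of
the window `B` (`d` = tree length), `R ≥ κ₀ + 4·2^d·τ` and `A e^{4·2^d τ} K₀ (2d+1) ≤ τ` (κ₀ = κ₀(4·2^d, 2d), K₀ = K₀(4·2^d, 2d)
of (1.26)), then [KoteckyPreiss1986] (1) holds on the whole gas with the size function `a(Z) = τ·#cells Z`:
`Σ_{Z′ touching Z} ‖H Z′‖ e^{a(Z′)} ≤ a(Z)`. [cite: Balaban1988RG2Cluster, p.20 (after (2.38))] -/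
theorem isKPVolume_window_of_decay [DecidableRel (Touch B)] {H : Dom B → ℂ} {A R τ : ℝ} (hA : 0 ≤ A) (hτ : 0 ≤ τ)
    (hH : ∀ Z : Dom B, ‖H Z‖ ≤ A * Real.exp (-(R * treeLen Z.1)))
    (hrate : kappa₀ (4 * 2 ^ d) (2 * d) + τ * (4 * 2 ^ d) ≤ R)
    (hsmall : A * Real.exp (τ * (4 * 2 ^ d)) * K₀ (4 * 2 ^ d) (2 * d) * (2 * (d : ℝ) + 1) ≤ τ) :
    IsKPVolume (Touch B) H (fun Z : Dom B => τ * ((cellsOf B Z.1).card : ℝ)) (Finset.univ : Finset (Dom B)) := by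
  classical
  have hkp := B13Resummation.kp_condition (Touch B) (cubes := fun Z : Dom B => cellsOf B Z.1) (reach := reach B)
    (d := fun Z : Dom B => treeLen Z.1) (w := H) (s := 0) (b := 0)
    (fun Z Z' h => loc_of_touch h) (card_reach_le B) (fun Z => treeLen_nonneg _) hA (K₀_pos _ _).le hτ hH
    (geometry B).ineq126 (geometry B).volBound (by rw [add_zero]; exact hrate) (by rw [zero_add]; exact hsmall)
  have h1 := fun γ => kp_hypothesis_of_fintype (inc := Touch B) (w := H)
    (a := fun Z : Dom B => τ * ((cellsOf B Z.1).card : ℝ)) (d := fun Z : Dom B => 0 * treeLen Z.1 + 0) hkp γ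
  have hdK : ∀ Z : Dom B, (0 : ℝ) ≤ 0 * treeLen Z.1 + 0 := fun Z => by simp
  exact isKPVolume_of_tsum_le (inc := Touch B) (w := H) (a := fun Z : Dom B => τ * ((cellsOf B Z.1).card : ℝ))
    (d := fun Z : Dom B => 0 * treeLen Z.1 + 0) hdK h1 Finset.univ

/-- The same from the rate and smallness letters of `…B14Eq344PolymerRatio.norm_E0_window_le_of_decay` (which are stronger:
`r₁ + 2κ₀ + 1 + 4·2^d τ ≤ R` with `r₁ ≥ 0`, and `A e^{b + 4·2^d τ} K₀ (2d+1) ≤ τ` with `b ≥ 5r₁ ≥ 0`). [cite: Balaban1988RG2Cluster, p.20 (after (2.38))] -/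
theorem isKPVolume_window_of_decayLetters [DecidableRel (Touch B)] {H : Dom B → ℂ} {A R r₁ b τ : ℝ} (hA : 0 ≤ A)
    (hτ : 0 ≤ τ) (hr₁ : 0 ≤ r₁) (hb : r₁ * 5 ≤ b)
    (hH : ∀ Z : Dom B, ‖H Z‖ ≤ A * Real.exp (-(R * treeLen Z.1)))
    (hrate : r₁ + 2 * kappa₀ (4 * 2 ^ d) (2 * d) + 1 + τ * (4 * 2 ^ d) ≤ R)
    (hsmall : A * Real.exp (b + τ * (4 * 2 ^ d)) * K₀ (4 * 2 ^ d) (2 * d) * (2 * (d : ℝ) + 1) ≤ τ) :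
    IsKPVolume (Touch B) H (fun Z : Dom B => τ * ((cellsOf B Z.1).card : ℝ)) (Finset.univ : Finset (Dom B)) := by
  have hκ₀ : 0 ≤ kappa₀ (4 * 2 ^ d) (2 * d) := kappa₀_nonneg (by positivity) _
  have hK : 0 ≤ K₀ (4 * 2 ^ d) (2 * d) := (K₀_pos _ _).le
  refine isKPVolume_window_of_decay B hA hτ hH (by linarith) (le_trans ?_ hsmall)
  have hb0 : 0 ≤ b := by linarith
  have hexp : Real.exp (τ * (4 * 2 ^ d)) ≤ Real.exp (b + τ * (4 * 2 ^ d)) := Real.exp_le_exp.mpr (by linarith)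
  have h2d : (0 : ℝ) ≤ 2 * (d : ℝ) + 1 := by positivity
  exact mul_le_mul_of_nonneg_right (mul_le_mul_of_nonneg_right (mul_le_mul_of_nonneg_left hexp hA) hK) h2d

/-! ## §2  The (3.47) bound from the activity letters alone -/

open Classical in
/-- **(3.47) p. 278 — «The terms of the sum above satisfy the bounds (2.42), with the constant B₀ replaced by O(p₀³(g_k))» —
FROM THE ACTIVITY LETTERS ALONE**: `…B14Eq344PolymerRatio.norm_E0_window_le_of_decay` with its Kotecký–Preiss hypothesis
DISCHARGED (§1).  For the window `B`: if the denominator activities obey `‖H Z‖ ≤ A e^{−R d(Z)}` and the marked ones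
`‖H′ Z₀‖ ≤ A′ e^{−R′ d(Z₀)}`, with the rate ∕ smallness conditions listed (κ₀, K₀ of (1.26), volume constant 4·2^d, degree 2d,
joining costs 5 and 2; free parameters τ, b, r₁, κ₂), then every (3.47) term at the cube `c` obeys
`‖𝐄₀(X, c)‖ ≤ A′ e^{2εe^{2κ}(2d+1)K₀·4·2^d} K₀ · e^{−κ·d(X)}`, `ε = τ·4·2^d·K₀·e^{−b}`. [cite: Balaban1988Convergent, (3.47) p.278] -/
theorem norm_E0_window_le_of_letters {H H' : Dom B → ℂ} (c : Cell B) {A A' R R' r₁ b τ κ κ₂ : ℝ} (hA : 0 ≤ A)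
    (hA' : 0 ≤ A') (hτ : 0 ≤ τ) (hr₁ : 0 ≤ r₁) (hb : r₁ * 5 ≤ b) (hκ : 0 ≤ κ)
    (hH : ∀ Z : Dom B, ‖H Z‖ ≤ A * Real.exp (-(R * treeLen Z.1)))
    (hH' : ∀ Z₀ : Dom B, ‖H' Z₀‖ ≤ A' * Real.exp (-(R' * treeLen Z₀.1)))
    (hrate : r₁ + 2 * kappa₀ (4 * 2 ^ d) (2 * d) + 1 + τ * (4 * 2 ^ d) ≤ R)
    (hsmall : A * Real.exp (b + τ * (4 * 2 ^ d)) * K₀ (4 * 2 ^ d) (2 * d) * (2 * (d : ℝ) + 1) ≤ τ)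
    (hε1 : τ * (4 * 2 ^ d) * K₀ (4 * 2 ^ d) (2 * d) * Real.exp (-b) ≤ 1)
    (hrκ : kappa₀ (4 * 2 ^ d) (2 * d) ≤ r₁ - κ) (hκ₂ : kappa₀ (4 * 2 ^ d) (2 * d) ≤ κ₂)
    (hrate' : κ + 2 * (τ * (4 * 2 ^ d) * K₀ (4 * 2 ^ d) (2 * d) * Real.exp (-b)) * Real.exp (κ * 2) *
        ((2 * (d : ℝ) + 1) * K₀ (4 * 2 ^ d) (2 * d)) * (4 * 2 ^ d) + κ₂ ≤ R')
    (X : Finset (Cell B)) :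
    ‖E0 (domsWith B c)
        (fun Z₀ => ((Finset.univ : Finset (Dom B)).powerset.image
          fun C => C.biUnion fun X => cellsOf B X.1).filter (TouchesCells B Z₀))
        (fun Z : Dom B => cellsOf B Z.1) H' (locE (Touch B) (fun Z : Dom B => cellsOf B Z.1) H) X‖ ≤
      A' * Real.exp (2 * (τ * (4 * 2 ^ d) * K₀ (4 * 2 ^ d) (2 * d) * Real.exp (-b)) * Real.exp (κ * 2) *
          ((2 * (d : ℝ) + 1) * K₀ (4 * 2 ^ d) (2 * d)) * (4 * 2 ^ d)) *
        K₀ (4 * 2 ^ d) (2 * d) * Real.exp (-(κ * dW B X)) :=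
  norm_E0_window_le_of_decay B (isKPVolume_window_of_decayLetters B hA hτ hr₁ hb hH hrate hsmall) c hA hA' hτ hr₁
    hb hκ hH hH' hrate hsmall hε1 hrκ hκ₂ hrate' X

/-! ## §3  Canonical parameters: explicit thresholds for a prescribed decay rate -/

/-- `K₀(c₀, Δ) ≥ 1` for `c₀ ≥ 1`: `K₀ = e^{κ₀}(Δ+1)^{−2}` with `κ₀ = c₀ a₀ ≥ a₀ = log(2(Δ+1)²)` (`…B12TreeDecay`, the (1.26)
constants of [Balaban1987RG1] in Dimock's explicit form). [folklore] -/
private theorem one_le_K₀ {c₀ : ℝ} (hc₀ : 1 ≤ c₀) (Δ : ℕ) : 1 ≤ K₀ c₀ Δ := by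
  have hΔ : (0 : ℝ) < ((Δ : ℝ) + 1) ^ 2 := by positivity
  have ha0 : 0 ≤ B12TreeDecay.a₀ Δ := B12TreeDecay.a₀_nonneg Δ
  have hexp : Real.exp (B12TreeDecay.a₀ Δ) = 2 * ((Δ : ℝ) + 1) ^ 2 := by
    unfold B12TreeDecay.a₀
    exact Real.exp_log (by positivity)
  have hk : B12TreeDecay.a₀ Δ ≤ kappa₀ c₀ Δ := by
    unfold B12TreeDecay.kappa₀
    nlinarith
  unfold B12TreeDecay.K₀
  rw [le_div_iff₀ hΔ, one_mul]
  calc ((Δ : ℝ) + 1) ^ 2 ≤ 2 * ((Δ : ℝ) + 1) ^ 2 := by nlinarith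
    _ = Real.exp (B12TreeDecay.a₀ Δ) := hexp.symm
    _ ≤ Real.exp (kappa₀ c₀ Δ) := Real.exp_le_exp.mpr hk

/-- The window's (1.26) constant is at least one: `1 ≤ K₀(4·2^d, 2d)`. [folklore] -/
private theorem one_le_K₀_window (d : ℕ) : 1 ≤ K₀ (4 * 2 ^ d) (2 * d) := by
  refine one_le_K₀ ?_ (2 * d)
  have h : (1 : ℝ) ≤ 2 ^ d := one_le_pow₀ (by norm_num)
  linarith

open Classical in
/-- **(3.47) p. 278 with the free parameters fixed — «O(1)·A′·e^{−κ d(X)}» for a PRESCRIBED rate `κ ≥ 0`.**  For the window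
`B`, denominator activities `‖H Z‖ ≤ A e^{−R d(Z)}` and marked activities `‖H′ Z₀‖ ≤ A′ e^{−R′ d(Z₀)}` with
`R ≥ κ + 3κ₀ + 2`, `R′ ≥ κ + κ₀ + 1` and `A · 2(4·2^d)²K₀³(2d+1)²e^{7κ + 5κ₀ + 1} ≤ 1` (κ₀ = κ₀(4·2^d, 2d), K₀ = K₀(4·2^d, 2d)
of (1.26)) give, for every (3.47) term at the cube `c`,  `‖𝐄₀(X, c)‖ ≤ (e·K₀)·A′·e^{−κ·d(X)}`.  This is §2 at the choice
`τ = (4·2^d)⁻¹`, `r₁ = κ + κ₀`, `b = 5r₁ + 2κ + log(2·4·2^d·K₀²·(2d+1))`, `κ₂ = κ₀` (one admissible choice; print: *«with the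
constant B₀ replaced by O(p₀³(g_k))»* — here O(1) = e·K₀ depends on `d` only and `A′` carries the `O(p₀³(g_k))`).
[cite: Balaban1988Convergent, (3.47) p.278] -/
theorem norm_E0_window_le_rate {H H' : Dom B → ℂ} (c : Cell B) {A A' R R' κ : ℝ} (hA : 0 ≤ A) (hA' : 0 ≤ A')
    (hκ : 0 ≤ κ)
    (hH : ∀ Z : Dom B, ‖H Z‖ ≤ A * Real.exp (-(R * treeLen Z.1)))
    (hH' : ∀ Z₀ : Dom B, ‖H' Z₀‖ ≤ A' * Real.exp (-(R' * treeLen Z₀.1)))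
    (hR : κ + 3 * kappa₀ (4 * 2 ^ d) (2 * d) + 2 ≤ R) (hR' : κ + kappa₀ (4 * 2 ^ d) (2 * d) + 1 ≤ R')
    (hAsmall : A * (2 * (4 * 2 ^ d) ^ 2 * K₀ (4 * 2 ^ d) (2 * d) ^ 3 * (2 * (d : ℝ) + 1) ^ 2 *
        Real.exp (7 * κ + 5 * kappa₀ (4 * 2 ^ d) (2 * d) + 1)) ≤ 1)
    (X : Finset (Cell B)) :
    ‖E0 (domsWith B c)
        (fun Z₀ => ((Finset.univ : Finset (Dom B)).powerset.image
          fun C => C.biUnion fun X => cellsOf B X.1).filter (TouchesCells B Z₀))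
        (fun Z : Dom B => cellsOf B Z.1) H' (locE (Touch B) (fun Z : Dom B => cellsOf B Z.1) H) X‖ ≤
      Real.exp 1 * K₀ (4 * 2 ^ d) (2 * d) * A' * Real.exp (-(κ * dW B X)) := by
  -- the constants of the window geometry
  set c₁ : ℝ := 4 * 2 ^ d with hc₁def
  set k₀ : ℝ := kappa₀ (4 * 2 ^ d) (2 * d) with hk₀def
  set K : ℝ := K₀ (4 * 2 ^ d) (2 * d) with hKdef
  set ν : ℝ := 2 * (d : ℝ) + 1 with hνdef
  have h2d : (1 : ℝ) ≤ 2 ^ d := one_le_pow₀ (by norm_num)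
  have hc₁ : (4 : ℝ) ≤ c₁ := by rw [hc₁def]; linarith
  have hc₁pos : 0 < c₁ := by linarith
  have hc₁ne : c₁ ≠ 0 := hc₁pos.ne'
  have hk₀ : 0 ≤ k₀ := kappa₀_nonneg (by positivity) _
  have hK1 : 1 ≤ K := one_le_K₀_window d
  have hKpos : 0 < K := by linarith
  have hν1 : 1 ≤ ν := by rw [hνdef]; have : (0 : ℝ) ≤ d := Nat.cast_nonneg d; linarith
  have hνpos : 0 < ν := by linarith
  -- the choice of the free parameters
  set τ : ℝ := c₁⁻¹ with hτdef
  set r₁ : ℝ := κ + k₀ with hr₁def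
  set P : ℝ := 2 * c₁ * K ^ 2 * ν with hPdef
  set b : ℝ := r₁ * 5 + (κ * 2 + Real.log P) with hbdef
  have hτpos : 0 < τ := inv_pos.mpr hc₁pos
  have hτc : τ * c₁ = 1 := inv_mul_cancel₀ hc₁ne
  have hr₁ : 0 ≤ r₁ := add_nonneg hκ hk₀
  have h2cKν : 1 ≤ 2 * c₁ * K * ν := by
    have h1 : c₁ ≤ c₁ * K := le_mul_of_one_le_right hc₁pos.le hK1
    have h2 : c₁ * K ≤ c₁ * K * ν := le_mul_of_one_le_right (by positivity) hν1
    linarith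
  have hKP : K ≤ P := by
    -- `K ≤ 2 c₁ K² ν` since `1 ≤ 2 c₁ K ν`
    have h := mul_le_mul_of_nonneg_left h2cKν hKpos.le
    calc K = K * 1 := (mul_one K).symm
      _ ≤ K * (2 * c₁ * K * ν) := h
      _ = P := by rw [hPdef]; ring
  have hP1 : 1 ≤ P := le_trans hK1 hKP
  have hPpos : 0 < P := by linarith
  have hexpb : Real.exp b = Real.exp (r₁ * 5) * (Real.exp (κ * 2) * P) := by
    rw [hbdef, Real.exp_add, Real.exp_add, Real.exp_log hPpos]
  have hexpb_ge : P ≤ Real.exp b := by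
    rw [hexpb]
    have h5 : 1 ≤ Real.exp (r₁ * 5) := Real.one_le_exp (by positivity)
    have h2 : 1 ≤ Real.exp (κ * 2) := Real.one_le_exp (by positivity)
    have h := mul_le_mul h5 (mul_le_mul h2 (le_refl P) hPpos.le (by positivity)) (by positivity) (by positivity)
    simpa using h
  -- the quantity `Q = 2εe^{2κ}(νK)c₁` of §2 equals `e^{−5r₁}` at this choice
  have hQ : 2 * (τ * (4 * 2 ^ d) * K * Real.exp (-b)) * Real.exp (κ * 2) * (ν * K) * (4 * 2 ^ d) =
      Real.exp (-(r₁ * 5)) := by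
    rw [← hc₁def, hτdef, Real.exp_neg, Real.exp_neg, hexpb, hPdef]
    have hE5 : Real.exp (r₁ * 5) ≠ 0 := (Real.exp_pos _).ne'
    have hE2 : Real.exp (κ * 2) ≠ 0 := (Real.exp_pos _).ne'
    field_simp
  have hQ1 : Real.exp (-(r₁ * 5)) ≤ 1 := Real.exp_le_one_iff.mpr (by linarith)
  have hb5 : r₁ * 5 ≤ b := by
    rw [hbdef]
    linarith [Real.log_nonneg hP1]
  -- §2 at this choice
  have hmain := norm_E0_window_le_of_letters B c (A := A) (A' := A') (R := R) (R' := R') (r₁ := r₁) (b := b)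
    (τ := τ) (κ := κ) (κ₂ := k₀) hA hA' hτpos.le hr₁ hb5 hκ hH hH' ?_ ?_ ?_ ?_ le_rfl ?_ X
  · refine hmain.trans ?_
    rw [hQ]
    have hexpQ : Real.exp (Real.exp (-(r₁ * 5))) ≤ Real.exp 1 := Real.exp_le_exp.mpr hQ1
    have hlast : 0 ≤ Real.exp (-(κ * dW B X)) := Real.exp_nonneg _
    calc A' * Real.exp (Real.exp (-(r₁ * 5))) * K * Real.exp (-(κ * dW B X))
        ≤ A' * Real.exp 1 * K * Real.exp (-(κ * dW B X)) := by gcongr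
      _ = Real.exp 1 * K * A' * Real.exp (-(κ * dW B X)) := by ring
  · -- rate: `r₁ + 2κ₀ + 1 + τc₁ = κ + 3κ₀ + 2 ≤ R`
    rw [← hc₁def, hτc]
    linarith
  · -- smallness: `A e^{b+1} K ν ≤ τ`
    rw [← hc₁def, hτc]
    have hE : Real.exp (b + 1) = Real.exp (7 * κ + 5 * k₀ + 1) * P := by
      rw [Real.exp_add, hexpb]
      have h3 : Real.exp (7 * κ + 5 * k₀ + 1) = Real.exp (r₁ * 5) * Real.exp (κ * 2) * Real.exp 1 := by
        rw [← Real.exp_add, ← Real.exp_add]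
        congr 1
        rw [hr₁def]
        ring
      rw [h3]
      ring
    have hlhs : A * Real.exp (b + 1) * K * ν =
        A * (2 * c₁ ^ 2 * K ^ 3 * ν ^ 2 * Real.exp (7 * κ + 5 * k₀ + 1)) * τ := by
      rw [hE, hPdef, hτdef]
      field_simp
    rw [hlhs]
    have := mul_le_mul_of_nonneg_right hAsmall hτpos.le
    simpa using this
  · -- `ε = τc₁K e^{−b} = K e^{−b} ≤ 1`
    rw [← hc₁def, hτc, one_mul, Real.exp_neg]
    rw [mul_inv_le_iff₀ (Real.exp_pos b), one_mul]
    exact hKP.trans hexpb_ge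
  · -- `κ₀ ≤ r₁ − κ`
    rw [hr₁def]
    linarith
  · -- rate of the marked activities: `κ + Q + κ₀ ≤ R′`
    rw [hQ]
    linarith

/-! ## §4  The `Step.LFHypImproved` shape of the pre-𝐑 new terms (p. 279, p. 262) at window level -/

open Classical in
/-- **THE INDUCTIVE-BOUND SHAPE FOR THE (3.47) TERMS** (p. 279: *«These terms satisfy all the conditions of the inductive
assumption»*; p. 262: the newly created terms *«have better decay properties, with the number κ replaced, for example, by
(1+4β)κ»*): for a TARGET constant `M` and a TARGET rate `κ⋆ ≥ 0` — read `κ⋆ := (1+4β)κ` and `M := E₀` for 𝐄^{(k+1)} (bound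
(I.1.18) ∕ (2.27)(iv)), `M := g^{κ₀}` for 𝐑″^{(k+1)} ((2.31)), `M := B₀` for 𝐁^{(k+1)} ((2.42)), i.e. the three fields
`boundE ∕ boundR ∕ boundB` of `Step.LFHypImproved` at the new index — activity letters at rates `R ≥ κ⋆ + 3κ₀ + 2`,
`R′ ≥ κ⋆ + κ₀ + 1` with the unmarked smallness of `norm_E0_window_le_rate` and the marked amplitude `e·K₀·A′ ≤ M` give
`‖𝐄₀(X, c)‖ ≤ M·e^{−κ⋆·d(X)}` for every (3.47) term. [cite: Balaban1988Convergent, p.279 and p.262] -/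
theorem norm_E0_window_le_target {H H' : Dom B → ℂ} (c : Cell B) {A A' R R' κt M : ℝ} (hA : 0 ≤ A) (hA' : 0 ≤ A')
    (hκt : 0 ≤ κt)
    (hH : ∀ Z : Dom B, ‖H Z‖ ≤ A * Real.exp (-(R * treeLen Z.1)))
    (hH' : ∀ Z₀ : Dom B, ‖H' Z₀‖ ≤ A' * Real.exp (-(R' * treeLen Z₀.1)))
    (hR : κt + 3 * kappa₀ (4 * 2 ^ d) (2 * d) + 2 ≤ R) (hR' : κt + kappa₀ (4 * 2 ^ d) (2 * d) + 1 ≤ R')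
    (hAsmall : A * (2 * (4 * 2 ^ d) ^ 2 * K₀ (4 * 2 ^ d) (2 * d) ^ 3 * (2 * (d : ℝ) + 1) ^ 2 *
        Real.exp (7 * κt + 5 * kappa₀ (4 * 2 ^ d) (2 * d) + 1)) ≤ 1)
    (hM : Real.exp 1 * K₀ (4 * 2 ^ d) (2 * d) * A' ≤ M) (X : Finset (Cell B)) :
    ‖E0 (domsWith B c)
        (fun Z₀ => ((Finset.univ : Finset (Dom B)).powerset.image
          fun C => C.biUnion fun X => cellsOf B X.1).filter (TouchesCells B Z₀))
        (fun Z : Dom B => cellsOf B Z.1) H' (locE (Touch B) (fun Z : Dom B => cellsOf B Z.1) H) X‖ ≤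
      M * Real.exp (-(κt * dW B X)) :=
  (norm_E0_window_le_rate B c hA hA' hκt hH hH' hR hR' hAsmall X).trans
    (mul_le_mul_of_nonneg_right hM (Real.exp_nonneg _))

open Classical in
/-- **The literal `(1+4β)κ` instance** (p. 262 *«for example, by (1+4β)κ»*; `Step.LFHypImproved`'s exponent
`−((1 + 4β)κ)·d`): with `β, κ ≥ 0`, letters at rates `R ≥ (1+4β)κ + 3κ₀ + 2`, `R′ ≥ (1+4β)κ + κ₀ + 1`, the unmarked
smallness at rate `(1+4β)κ` and `e·K₀·A′ ≤ M`:  `‖𝐄₀(X, c)‖ ≤ M·exp(−((1+4β)κ)·d(X))`. [cite: Balaban1988Convergent, p.262] -/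
theorem norm_E0_window_le_improved {H H' : Dom B → ℂ} (c : Cell B) {A A' R R' βc κ M : ℝ} (hA : 0 ≤ A) (hA' : 0 ≤ A')
    (hβ : 0 ≤ βc) (hκ : 0 ≤ κ)
    (hH : ∀ Z : Dom B, ‖H Z‖ ≤ A * Real.exp (-(R * treeLen Z.1)))
    (hH' : ∀ Z₀ : Dom B, ‖H' Z₀‖ ≤ A' * Real.exp (-(R' * treeLen Z₀.1)))
    (hR : (1 + 4 * βc) * κ + 3 * kappa₀ (4 * 2 ^ d) (2 * d) + 2 ≤ R)
    (hR' : (1 + 4 * βc) * κ + kappa₀ (4 * 2 ^ d) (2 * d) + 1 ≤ R')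
    (hAsmall : A * (2 * (4 * 2 ^ d) ^ 2 * K₀ (4 * 2 ^ d) (2 * d) ^ 3 * (2 * (d : ℝ) + 1) ^ 2 *
        Real.exp (7 * ((1 + 4 * βc) * κ) + 5 * kappa₀ (4 * 2 ^ d) (2 * d) + 1)) ≤ 1)
    (hM : Real.exp 1 * K₀ (4 * 2 ^ d) (2 * d) * A' ≤ M) (X : Finset (Cell B)) :
    ‖E0 (domsWith B c)
        (fun Z₀ => ((Finset.univ : Finset (Dom B)).powerset.image
          fun C => C.biUnion fun X => cellsOf B X.1).filter (TouchesCells B Z₀))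
        (fun Z : Dom B => cellsOf B Z.1) H' (locE (Touch B) (fun Z : Dom B => cellsOf B Z.1) H) X‖ ≤
      M * Real.exp (-((1 + 4 * βc) * κ) * dW B X) := by
  have hκt : 0 ≤ (1 + 4 * βc) * κ := by positivity
  have h := norm_E0_window_le_target B c hA hA' hκt hH hH' hR hR' hAsmall hM X
  have he : -((1 + 4 * βc) * κ) * dW B X = -((1 + 4 * βc) * κ * dW B X) := by ring
  rw [he]
  exact h

end Literature.MathematicalPhysics.QuantumFieldTheory.Balaban1983to89.B14.Eq347Letters
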